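/-
Origin: expansion seat `planner-pub-hodgecm-pv06-g2-0`, handover (a) 2026-08-18T05:22:59Z (owner cf-HM4 05:27:46Z: canonical) (`HOME/pub-hodgecm-pv06-g2/lean/Pv06g2/RealApproximationUnitary.lean`, md5 8634c553, 377 lines);
landed by the gen-6 packager in gate run 23 as `HodgeCM/Literature/RealApproximationUnitary.lean` (import ^import Pv06g2\.Mirror\.→import HodgeCM.Literature. ×1).
-/
/-
Origin: HOME/pub-hodgecm-pv06-g2/lean/Pv06g2/RealApproximationUnitary.lean — session planner-pub-hodgecm-pv06-g2-0 (unit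
pub-hodgecm-pv06-g2, DAG-NODE PROVER #06 of 15, generation 2).  Intended final place:
`HodgeCM/Literature/RealApproximationUnitary.lean` (namespace `HodgeCM.Literature.RealApproximation`, the namespace of the
file it extends).  WIP import to rewrite at intake: `Pv06g2.Mirror.RealApproximation` (a byte-identical mirror of
cf-hasseminkowski-g4's `CfHM4/RealApproximation.lean` **v2** md5 bfc0e30be33e, kept only for type-checking) ↦
`HodgeCM.Literature.RealApproximation`.  REQUIRES v2 of that file (its Parts A–E: `skewElem`, `sum_skewElem_eq`,
`map_skewElemL`, `cayley_mem`, `cayleyInv_mem_lie`, `cayleyInv_eq`, `infinite_normOne_image`, `conjTranspose_map_eq'`,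
`map_nonsing_inv_eq`, `det_ne_zero_of_unitary`, `denseRange_embeddings`).  Closed; nothing cited; nothing posited.

# Real approximation for unitary groups of hermitian spaces over a CM field — at ALL archimedean places (KERNEL)

PerL v5, Prop. 3.6 Step 2 (tex ll. 430–433; DAG node N23c, field `HodgeCM.PerL34.Annihilation.AnnihilationDatum.dense`,
hypothesis `hRA` of `HodgeCM.PerL34.DenseOrbit.dense_of_denseRange_fst`): "real approximation for the connected reductive
group `U(W)` ([San, Cor. 3.5(iii)], [PR, Thm. 7.7]) gives `γ ∈ U(W)(L₀)` close to `x_∞` in `U(W)(L₀ ⊗ ℝ)`", where `W` is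
the hermitian PLANE of l. 314 (adversarial reader adv1-g6, objection O6: the torus case `RealApproximation_U1` does NOT
cover this).  The published theorem ([GH24] Thm. 2.5.2 p. 42; [Bor09] Cor. 3.13; CITED-FACTS RA-1) is about an arbitrary
connected group; what PerL uses is the following special case, which this file PROVES for every finite index type `m`
and every non-degenerate `σ`-hermitian matrix `H ∈ M_m(L)` (`σ` = complex conjugation of the CM field `L`, `L₀ = L^σ`):

  the image of `U(H)(L₀) = {g ∈ GL_m(L) : σ(g)ᵀ H g = H}` under the joint archimedean embedding
  `g ↦ (w(g))_{w : InfinitePlace L}` is dense in `U(H)(L₀ ⊗_ℚ ℝ) = ∏_{w} U(H^w)`, `U(H^w) = {u ∈ M_m(ℂ) : uᴴ H^w u = H^w}`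

(the infinite places `w` of the CM field `L` are complex and correspond bijectively to the real places `v` of `L₀`,
with `U(H)(L₀,v) = U(H^w)`).  Proof = cf-HM4's Cayley-transform proof of the one-place case (`unitary_mem_closure`), run at
all places SIMULTANEOUSLY: (A') `σ`-skew matrices over `L` are jointly dense in `∏_w {skew-hermitian}` — entrywise, from
Mathlib's weak approximation `L → ∏_w ℂ` dense (`denseRange_embeddings`); (B') hence `Lie U(H)(L₀) = Skew_σ(L)·H` is jointly
dense in `∏_w 𝔲(H^w)`; (D') one scalar `a ∈ U(1)(L₀)` with `w(a) + u_w` invertible at every `w` (finitely many bad values,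
`U(1)(L₀)` infinite); (C, E') the inverse Cayley transforms `X_w` of the `u_w` are approximated jointly by a rational
`Y ∈ Lie U(H)(L₀)` with `1 + Y` invertible, and `g = a (1 − Y)(1 + Y)⁻¹ ∈ U(H)(L₀)` is jointly close to `u`.
-/
import Summits.HodgeConjecture.HodgeCM.Literature.RealApproximation_3

/-! PORT of `HodgeCM/Literature/RealApproximationUnitary.lean` (HodgeCMPerL run 82) — verbatim mechanical port; provenance in the PORT header line. -/

set_option autoImplicit false

noncomputable section

open NumberField NumberField.InfinitePlace Topology Matrix
open Literature.AlgebraicGeometry.ShimuraVarieties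

namespace HodgeCM.Literature

namespace RealApproximation

section Pi

variable (L : CMField) {m : Type*} [Fintype m] [DecidableEq m]

/-- The joint archimedean image of an `L`-matrix: `Y ↦ (w(Y))_{w : InfinitePlace L}`. -/
def piMap (Y : Matrix m m L) : InfinitePlace L → Matrix m m ℂ := fun w => Y.map w.embedding

omit [Fintype m] [DecidableEq m] in
/-- (Ported verbatim from the HodgeCMPerL package; no docstring in the source.) -/
@[simp] theorem piMap_apply (Y : Matrix m m L) (w : InfinitePlace L) : piMap L Y w = Y.map w.embedding := rfl

/-! #### Part A' — joint skew-hermitian approximation -/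

/-- The `σ`-skew-hermitian matrices over `L`: `σ(Z)ᵀ = −Z`. -/
def skewSetσ : Set (Matrix m m L) := {Z | (Z.map (conjRingHomK L))ᵀ = -Z}

omit [Fintype m] [DecidableEq m] in
/-- `σ`-skew over `L` ⟺ skew-hermitian at one (any) complex embedding. -/
theorem mem_skewSetσ_iff (Z : Matrix m m L) (φ : L →+* ℂ) : Z ∈ skewSetσ (m := m) L ↔ (Z.map φ)ᴴ = -(Z.map φ) := by
  simp only [skewSetσ, Set.mem_setOf_eq]
  constructor
  · intro h
    rw [conjTranspose_map_eq', h, Matrix.map_neg _ (map_neg φ)]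
  · intro h
    apply Matrix.map_injective φ.injective
    change ((Z.map (conjRingHomK L))ᵀ).map φ = (-Z).map φ
    rw [← conjTranspose_map_eq' L φ Z, Matrix.map_neg _ (map_neg φ), h]

/-- The joint images of the `σ`-skew matrices, an additive submonoid of `∏_w M_m(ℂ)`. -/
def skewImgPi : AddSubmonoid (InfinitePlace L → Matrix m m ℂ) where
  carrier := piMap (m := m) L '' skewSetσ L
  zero_mem' := by
    refine ⟨0, ?_, ?_⟩
    · simp only [skewSetσ, Set.mem_setOf_eq, Matrix.map_zero _ (map_zero _), Matrix.transpose_zero, neg_zero]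
    · funext w; simp [piMap]
  add_mem' := by
    rintro _ _ ⟨Z, hZ, rfl⟩ ⟨Z', hZ', rfl⟩
    refine ⟨Z + Z', ?_, ?_⟩
    · simp only [skewSetσ, Set.mem_setOf_eq] at hZ hZ' ⊢
      rw [Matrix.map_add _ (map_add _), Matrix.transpose_add, hZ, hZ', neg_add]
    · funext w; simp [piMap, Matrix.map_add _ (map_add w.embedding)]

omit [Fintype m] in
/-- Every joint elementary skew-hermitian family `(E(i,j;c_w))_w` is a limit of joint images of `σ`-skew matrices over `L`
(weak approximation: `L → ∏_w ℂ` has dense range). -/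
theorem skewElemPi_mem_closure (i j : m) (c : InfinitePlace L → ℂ) :
    (fun w => skewElem i j (c w)) ∈
      closure ((skewImgPi (m := m) L : AddSubmonoid (InfinitePlace L → Matrix m m ℂ)) : Set _) := by
  have hd : DenseRange (fun x : L => fun w : InfinitePlace L => w.embedding x) := denseRange_embeddings L
  have hc : c ∈ closure (Set.range fun x : L => fun w : InfinitePlace L => w.embedding x) := by
    rw [hd.closure_range]; trivial
  let F : (InfinitePlace L → ℂ) → (InfinitePlace L → Matrix m m ℂ) := fun d w => skewElem i j (d w)
  have hF : Continuous F := continuous_pi fun w => (continuous_skewElem i j).comp (continuous_apply w)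
  have h1 : F c ∈ closure (F '' Set.range fun x : L => fun w : InfinitePlace L => w.embedding x) :=
    ContinuousWithinAt.mem_closure_image hF.continuousWithinAt hc
  refine closure_mono ?_ h1
  rintro _ ⟨_, ⟨x, rfl⟩, rfl⟩
  obtain ⟨w₀⟩ := (inferInstance : Nonempty (InfinitePlace L))
  refine ⟨x • Matrix.single i j (1 : L) - (conjRingHomK L x) • Matrix.single j i (1 : L), ?_, ?_⟩
  · rw [mem_skewSetσ_iff L _ w₀.embedding, map_skewElemL L w₀.embedding i j x, conjTranspose_skewElem]
  · funext w
    exact map_skewElemL L w.embedding i j x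

/-- **Part A'.** Every family of skew-hermitian matrices `(Y_w)_w` is a limit of joint images of `σ`-skew matrices. -/
theorem skewPi_mem_closure (Y : InfinitePlace L → Matrix m m ℂ) (hY : ∀ w, (Y w)ᴴ = -Y w) :
    Y ∈ closure ((skewImgPi (m := m) L : AddSubmonoid (InfinitePlace L → Matrix m m ℂ)) : Set _) := by
  have hsum : ∑ i, ∑ j, (fun w => skewElem i j (Y w i j / 2)) = Y := by
    funext w
    simp only [Finset.sum_apply]
    exact sum_skewElem_eq (Y w) (hY w)
  rw [← AddSubmonoid.coe_topologicalClosure, ← hsum]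
  refine AddSubmonoid.sum_mem _ fun i _ => AddSubmonoid.sum_mem _ fun j _ => ?_
  have := skewElemPi_mem_closure (m := m) L i j (fun w => Y w i j / 2)
  rwa [← AddSubmonoid.coe_topologicalClosure] at this

/-! #### Part B' — `Lie U(H)(L₀)` is jointly dense in `∏_w 𝔲(H^w)` -/

variable (Hm : Matrix m m L)

/-- `Lie U(H)(L₀) = {Y ∈ M_m(L) : σ(Y)ᵀ H + H Y = 0}`. -/
def lieSetσ : Set (Matrix m m L) := {Y | (Y.map (conjRingHomK L))ᵀ * Hm + Hm * Y = 0}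

omit [DecidableEq m] in
/-- (Ported verbatim from the HodgeCMPerL package; no docstring in the source.) -/
theorem mem_lieSetσ_iff (Y : Matrix m m L) (φ : L →+* ℂ) :
    Y ∈ lieSetσ (m := m) L Hm ↔ (Y.map φ)ᴴ * Hm.map φ + Hm.map φ * Y.map φ = 0 := by
  simp only [lieSetσ, Set.mem_setOf_eq]
  have key : ((Y.map (conjRingHomK L))ᵀ * Hm + Hm * Y).map φ = (Y.map φ)ᴴ * Hm.map φ + Hm.map φ * Y.map φ := by
    rw [Matrix.map_add _ (map_add φ), Matrix.map_mul, Matrix.map_mul, conjTranspose_map_eq']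
  constructor
  · intro h
    rw [← key, h, Matrix.map_zero _ (map_zero φ)]
  · intro h
    apply Matrix.map_injective φ.injective
    change ((Y.map (conjRingHomK L))ᵀ * Hm + Hm * Y).map φ = (0 : Matrix m m L).map φ
    rw [key, h, Matrix.map_zero _ (map_zero φ)]

omit [Fintype m] [DecidableEq m] in
/-- (Ported verbatim from the HodgeCMPerL package; no docstring in the source.) -/
theorem conjTranspose_map_of_hermitian (hH : (Hm.map (conjRingHomK L))ᵀ = Hm) (φ : L →+* ℂ) :
    (Hm.map φ)ᴴ = Hm.map φ := by
  rw [conjTranspose_map_eq', hH]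

/-- (Ported verbatim from the HodgeCMPerL package; no docstring in the source.) -/
theorem isUnit_det_map (hdet : IsUnit Hm.det) (φ : L →+* ℂ) : IsUnit (Hm.map φ).det := by
  rw [isUnit_iff_ne_zero]
  intro h0
  have := RingHom.map_det φ Hm
  rw [RingHom.mapMatrix_apply, h0, map_eq_zero] at this
  exact hdet.ne_zero this

/-- **Part B'.** For `H` `σ`-hermitian and non-degenerate, every family `(X_w)_w` with `X_w ∈ 𝔲(H^w)` is a limit of joint
images of elements of `Lie U(H)(L₀)`. -/
theorem liePi_mem_closure (hH : (Hm.map (conjRingHomK L))ᵀ = Hm) (hdet : IsUnit Hm.det)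
    (X : InfinitePlace L → Matrix m m ℂ)
    (hX : ∀ w, (X w)ᴴ * Hm.map w.embedding + Hm.map w.embedding * X w = 0) :
    X ∈ closure (piMap (m := m) L '' lieSetσ L Hm) := by
  have hHw : ∀ w : InfinitePlace L, (Hm.map w.embedding)ᴴ = Hm.map w.embedding :=
    fun w => conjTranspose_map_of_hermitian L Hm hH w.embedding
  have hdw : ∀ w : InfinitePlace L, IsUnit (Hm.map w.embedding).det := fun w => isUnit_det_map L Hm hdet w.embedding
  set W : InfinitePlace L → Matrix m m ℂ := fun w => X w * (Hm.map w.embedding)⁻¹ with hWd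
  have hWskew : ∀ w, (W w)ᴴ = -W w := by
    intro w
    set Hc := Hm.map w.embedding with hHc
    have hXH : (X w)ᴴ * Hc = -(Hc * X w) := eq_neg_of_add_eq_zero_left (hX w)
    change (X w * Hc⁻¹)ᴴ = -(X w * Hc⁻¹)
    rw [Matrix.conjTranspose_mul, Matrix.conjTranspose_nonsing_inv, hHw w]
    have h1 : Hc⁻¹ * ((X w)ᴴ * Hc) * Hc⁻¹ = Hc⁻¹ * (-(Hc * X w)) * Hc⁻¹ := by rw [hXH]
    have h2 : Hc⁻¹ * ((X w)ᴴ * Hc) * Hc⁻¹ = Hc⁻¹ * (X w)ᴴ := by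
      rw [Matrix.mul_assoc, Matrix.mul_assoc, Matrix.mul_nonsing_inv _ (hdw w), Matrix.mul_one]
    have h3 : Hc⁻¹ * (-(Hc * X w)) * Hc⁻¹ = -(X w * Hc⁻¹) := by
      rw [Matrix.mul_neg, Matrix.neg_mul, ← Matrix.mul_assoc, Matrix.nonsing_inv_mul _ (hdw w), Matrix.one_mul]
    rw [← h2, h1, h3]
  have hWc := skewPi_mem_closure (m := m) L W hWskew
  have hR : Continuous fun M : InfinitePlace L → Matrix m m ℂ => fun w => M w * Hm.map w.embedding :=
    continuous_pi fun w => (continuous_apply w).mul continuous_const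
  have hX' : X = fun w => W w * Hm.map w.embedding := by
    funext w
    simp only [hWd]
    rw [Matrix.mul_assoc, Matrix.nonsing_inv_mul _ (hdw w), Matrix.mul_one]
  have hmem : (fun w => W w * Hm.map w.embedding) ∈
      closure ((fun M : InfinitePlace L → Matrix m m ℂ => fun w => M w * Hm.map w.embedding) ''
        ((skewImgPi (m := m) L : AddSubmonoid _) : Set _)) :=
    ContinuousWithinAt.mem_closure_image hR.continuousWithinAt hWc
  rw [hX']
  refine closure_mono ?_ hmem
  rintro _ ⟨_, ⟨Z, hZ, rfl⟩, rfl⟩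
  refine ⟨Z * Hm, ?_, ?_⟩
  · simp only [lieSetσ, skewSetσ, Set.mem_setOf_eq] at hZ ⊢
    rw [Matrix.map_mul, Matrix.transpose_mul, hH, hZ]
    simp only [Matrix.neg_mul, Matrix.mul_neg, Matrix.mul_assoc, neg_add_cancel]
  · funext w
    simp only [piMap, Matrix.map_mul]

/-! #### Part D' — one unit scalar good at every place -/

omit [Fintype m] [DecidableEq m] in
/-- (Ported verbatim from the HodgeCMPerL package; no docstring in the source.) -/
theorem normOne_infinite : (normOne L).Infinite := by
  obtain ⟨w₀⟩ := (inferInstance : Nonempty (InfinitePlace L))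
  exact Set.Infinite.of_image _ (infinite_normOne_image L w₀.embedding)

/-- **Part D'.** For every family of complex matrices `(u_w)_w` there is `a ∈ U(1)(L₀)` with `w(a)·1 + u_w` invertible for
ALL `w` (each `w` excludes the finitely many `a` with `w(a)` an eigenvalue of `−u_w`; `U(1)(L₀)` is infinite). -/
theorem exists_normOne_isUnit_pi (u : InfinitePlace L → Matrix m m ℂ) :
    ∃ a : L, a ∈ normOne L ∧ ∀ w : InfinitePlace L, IsUnit ((w.embedding a) • (1 : Matrix m m ℂ) + u w).det := by
  classical
  let bad : Set L := ⋃ w : InfinitePlace L, (w.embedding) ⁻¹' {z : ℂ | Polynomial.IsRoot (-u w).charpoly z}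
  have hbad : bad.Finite := by
    refine Set.finite_iUnion fun w => ?_
    exact (Polynomial.finite_setOf_isRoot (Matrix.charpoly_monic (-u w)).ne_zero).preimage
      (Set.injOn_of_injective w.embedding.injective)
  obtain ⟨a, ha, hab⟩ := (normOne_infinite L).exists_notMem_finite hbad
  refine ⟨a, ha, fun w => isUnit_iff_ne_zero.mpr fun h0 => hab ?_⟩
  refine Set.mem_iUnion.mpr ⟨w, ?_⟩
  simp only [Set.mem_preimage, Set.mem_setOf_eq, Polynomial.IsRoot.def, Matrix.eval_charpoly, Matrix.scalar_apply,
    ← Matrix.smul_one_eq_diagonal, sub_neg_eq_add]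
  exact h0

/-! #### Part E' — joint density at the matrix level -/

/-- **Real approximation for `U(H)`, all archimedean places at once (matrix level).**  For `H ∈ M_m(L)` `σ`-hermitian with
`det H ≠ 0`, every family `(u_w)_{w : InfinitePlace L}` with `u_w ∈ U(H^w)` is a limit of joint archimedean images
`(w(g))_w` of elements `g ∈ U(H)(L₀) = unitaryGroup σ H`. -/
theorem unitaryPi_mem_closure (hH : (Hm.map (conjRingHomK L))ᵀ = Hm) (hdet : IsUnit Hm.det)
    (u : InfinitePlace L → Matrix m m ℂ) (hu : ∀ w, (u w)ᴴ * Hm.map w.embedding * u w = Hm.map w.embedding) :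
    u ∈ closure {x : InfinitePlace L → Matrix m m ℂ |
      ∃ g : GL m L, g ∈ unitaryGroup (conjRingHomK L) Hm ∧ piMap L (g : Matrix m m L) = x} := by
  classical
  have hdw : ∀ w : InfinitePlace L, IsUnit (Hm.map w.embedding).det := fun w => isUnit_det_map L Hm hdet w.embedding
  -- Part D': the scalar
  obtain ⟨a, ha, hA⟩ := exists_normOne_isUnit_pi (m := m) L u
  have hα : ∀ w : InfinitePlace L, starRingEnd ℂ (w.embedding a) * w.embedding a = 1 :=
    fun w => conj_mul_of_mem_normOne L w.embedding ha
  have hα0 : ∀ w : InfinitePlace L, w.embedding a ≠ 0 := fun w => ne_zero_of_mem_normOne L w.embedding ha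
  -- Part C: inverse Cayley transforms, place by place
  set X : InfinitePlace L → Matrix m m ℂ :=
    fun w => ((w.embedding a) • (1 : Matrix m m ℂ) + u w)⁻¹ * ((w.embedding a) • 1 - u w) with hXd
  have hXlie : ∀ w, (X w)ᴴ * Hm.map w.embedding + Hm.map w.embedding * X w = 0 :=
    fun w => cayleyInv_mem_lie (hu w) (hα w) (hA w)
  have hcay : ∀ w, IsUnit (1 + X w).det ∧ (w.embedding a) • ((1 - X w) * (1 + X w)⁻¹) = u w :=
    fun w => cayleyInv_eq (hα0 w) (hA w)
  -- Part B': joint approximation of `X` inside the open set `{∀ w, det(1 + M_w) ≠ 0}`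
  have hXc : X ∈ closure (piMap (m := m) L '' lieSetσ L Hm) := liePi_mem_closure L Hm hH hdet X hXlie
  let O : Set (InfinitePlace L → Matrix m m ℂ) := {M | ∀ w, (1 + M w).det ≠ 0}
  have hO : IsOpen O := by
    have : O = ⋂ w, {M : InfinitePlace L → Matrix m m ℂ | (1 + M w).det ≠ 0} := by
      ext M; simp [O]
    rw [this]
    exact isOpen_iInter_of_finite fun w =>
      isOpen_ne.preimage ((continuous_const.add (continuous_apply w)).matrix_det)
  have hXO : X ∈ O := fun w => (hcay w).1.ne_zero
  have hXc' : X ∈ closure (O ∩ piMap (m := m) L '' lieSetσ L Hm) := hO.inter_closure ⟨hXO, hXc⟩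
  -- the joint Cayley map, continuous at `X`
  let c : (InfinitePlace L → Matrix m m ℂ) → (InfinitePlace L → Matrix m m ℂ) :=
    fun M w => (w.embedding a) • ((1 - M w) * (1 + M w)⁻¹)
  have hc : ContinuousAt c X := by
    refine continuousAt_pi.mpr fun w => ?_
    -- the one-place Cayley map `cw`, continuous at `X w` (as in `unitary_mem_closure`)
    let cw : Matrix m m ℂ → Matrix m m ℂ := fun N => (w.embedding a) • ((1 - N) * (1 + N)⁻¹)
    have hcw : ContinuousAt cw (X w) := by
      have h1 : ContinuousAt (fun N : Matrix m m ℂ => (1 + N)⁻¹) (X w) := by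
        have hi : ContinuousAt Ring.inverse (1 + X w).det := by
          rw [Ring.inverse_eq_inv']
          exact continuousAt_inv₀ (hcay w).1.ne_zero
        exact (continuousAt_matrix_inv (1 + X w) hi).comp (continuous_const.add continuous_id).continuousAt
      exact ((continuous_const.sub continuous_id).continuousAt.mul h1).const_smul (w.embedding a)
    have hcomp : ContinuousAt (cw ∘ fun M : InfinitePlace L → Matrix m m ℂ => M w) X :=
      ContinuousAt.comp (f := fun M : InfinitePlace L → Matrix m m ℂ => M w) (x := X) hcw
        (continuous_apply w).continuousAt
    exact hcomp
  have hmem : c X ∈ closure (c '' (O ∩ piMap (m := m) L '' lieSetσ L Hm)) :=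
    ContinuousWithinAt.mem_closure_image hc.continuousWithinAt hXc'
  have hcX : c X = u := funext fun w => (hcay w).2
  rw [hcX] at hmem
  refine closure_mono ?_ hmem
  -- a rational Lie element with `det(1 + ·) ≠ 0` (at every place) has Cayley image in the joint image of `U(H)(L₀)`
  rintro _ ⟨M, ⟨hMO, ⟨Y, hY, rfl⟩⟩, rfl⟩
  have hY' : ∀ w : InfinitePlace L,
      (Y.map w.embedding)ᴴ * Hm.map w.embedding + Hm.map w.embedding * Y.map w.embedding = 0 :=
    fun w => (mem_lieSetσ_iff L Hm Y w.embedding).mp hY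
  have h1M : ∀ w : InfinitePlace L, IsUnit (1 + Y.map w.embedding).det := fun w => isUnit_iff_ne_zero.mpr (hMO w)
  obtain ⟨w₀⟩ := (inferInstance : Nonempty (InfinitePlace L))
  have h1Y : IsUnit (1 + Y).det := by
    rw [isUnit_iff_ne_zero]
    intro h0
    apply hMO w₀
    have := RingHom.map_det w₀.embedding (1 + Y)
    rw [h0, map_zero, RingHom.mapMatrix_apply, Matrix.map_add _ (map_add _),
      Matrix.map_one _ (map_zero _) (map_one _)] at this
    exact this.symm
  set gM : Matrix m m L := a • ((1 - Y) * (1 + Y)⁻¹) with hgM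
  have hgMmap : ∀ w : InfinitePlace L, gM.map w.embedding = c (piMap L Y) w := by
    intro w
    have hsmul : ∀ N : Matrix m m L, (a • N).map w.embedding = w.embedding a • N.map w.embedding := by
      intro N; ext i j; simp
    change gM.map w.embedding = (w.embedding a) • ((1 - Y.map w.embedding) * (1 + Y.map w.embedding)⁻¹)
    rw [hgM, hsmul, Matrix.map_mul, map_nonsing_inv_eq L w.embedding _ h1Y, Matrix.map_sub _ (map_sub _),
      Matrix.map_add _ (map_add _), Matrix.map_one _ (map_zero _) (map_one _)]
  have hcmem : ∀ w : InfinitePlace L,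
      (c (piMap L Y) w)ᴴ * Hm.map w.embedding * c (piMap L Y) w = Hm.map w.embedding :=
    fun w => cayley_mem (hY' w) (h1M w) (hα w)
  have hgdet : gM.det ≠ 0 := by
    intro h0
    have := RingHom.map_det w₀.embedding gM
    rw [h0, map_zero, RingHom.mapMatrix_apply, hgMmap] at this
    exact det_ne_zero_of_unitary (hdw w₀) (hcmem w₀) this.symm
  refine ⟨Matrix.GeneralLinearGroup.mkOfDetNeZero gM hgdet, ?_, ?_⟩
  · rw [Literature.AlgebraicGeometry.ShimuraVarieties.mem_unitaryGroup_iff]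
    apply Matrix.map_injective w₀.embedding.injective
    change (((gM.map (conjRingHomK L))ᵀ * Hm * gM).map w₀.embedding) = Hm.map w₀.embedding
    rw [Matrix.map_mul, Matrix.map_mul, ← conjTranspose_map_eq', hgMmap, hcmem]
  · funext w
    exact hgMmap w

/-! #### The typed statement and its `DenseRange` forms -/

/-- `U(H)(L₀ ⊗ ℝ) = ∏_{w : InfinitePlace L} U(H^w)` as a subset of `∏_w M_m(ℂ)`. -/
def unitaryPiSet : Set (InfinitePlace L → Matrix m m ℂ) :=
  {u | ∀ w, (u w)ᴴ * Hm.map w.embedding * u w = Hm.map w.embedding}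

omit [DecidableEq m] in
/-- (Ported verbatim from the HodgeCMPerL package; no docstring in the source.) -/
theorem isClosed_unitaryPiSet : IsClosed (unitaryPiSet (m := m) L Hm) := by
  have : unitaryPiSet (m := m) L Hm =
      ⋂ w, {u : InfinitePlace L → Matrix m m ℂ | (u w)ᴴ * Hm.map w.embedding * u w = Hm.map w.embedding} := by
    ext u; simp [unitaryPiSet]
  rw [this]
  refine isClosed_iInter fun w => isClosed_eq ?_ continuous_const
  have h1 : Continuous fun u : InfinitePlace L → Matrix m m ℂ => u w := continuous_apply w
  exact ((continuous_id.matrix_conjTranspose.comp h1).mul continuous_const).mul h1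

/-- (Ported verbatim from the HodgeCMPerL package; no docstring in the source.) -/
theorem piMap_mem_unitaryPiSet {g : GL m L} (hg : g ∈ unitaryGroup (conjRingHomK L) Hm) :
    piMap L (g : Matrix m m L) ∈ unitaryPiSet (m := m) L Hm := by
  intro w
  have h := Literature.AlgebraicGeometry.ShimuraVarieties.mem_unitaryGroup_iff.mp hg
  have h2 := congrArg (fun M : Matrix m m L => M.map w.embedding) h
  simp only [Matrix.map_mul] at h2
  rwa [← conjTranspose_map_eq'] at h2

/-- The joint archimedean embedding `U(H)(L₀) → U(H)(L₀ ⊗ ℝ) = ∏_w U(H^w)`. -/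
def archEmb (g : unitaryGroup (conjRingHomK L) Hm) : unitaryPiSet (m := m) L Hm :=
  ⟨piMap L ((g : GL m L) : Matrix m m L), piMap_mem_unitaryPiSet L Hm g.2⟩

/-- **Real approximation for `U(H)` over the CM field `L` (all hermitian `H`, all archimedean places): the archimedean
embedding `U(H)(L₀) → U(H)(L₀ ⊗ ℝ)` has dense range.**  For `H` the Gram matrix of PerL's hermitian plane `W` this is the
`hRA` input of `HodgeCM.PerL34.DenseOrbit.dense_of_denseRange_fst` / the real-approximation half of
`AnnihilationDatum.dense` (node N23c). -/
theorem denseRange_archEmb (hH : (Hm.map (conjRingHomK L))ᵀ = Hm) (hdet : IsUnit Hm.det) :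
    DenseRange (archEmb (m := m) L Hm) := by
  rw [DenseRange, Subtype.dense_iff]
  intro u hu
  have h := unitaryPi_mem_closure L Hm hH hdet u hu
  refine closure_mono ?_ h
  rintro _ ⟨g, hg, rfl⟩
  exact ⟨⟨piMap L (g : Matrix m m L), piMap_mem_unitaryPiSet L Hm hg⟩, ⟨⟨g, hg⟩, rfl⟩, rfl⟩

end Pi

end RealApproximation

/-- **RA-H, the special case of [GH24] Thm. 2.5.2 / [PR] Thm. 7.7 / [San] Cor. 3.5(iii) / [Bor09] Cor. 3.13 that PerL v5
ll. 430–433 uses (`G = U(W)`, `W` a hermitian space over the CM field `L/L₀`, `S = V_∞`), typed for EVERY finite index type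
and every non-degenerate `σ`-hermitian Gram matrix:** the joint archimedean image of `U(H)(L₀)` is dense in
`∏_{w ∣ ∞} U(H^w) = U(H)(L₀ ⊗ ℝ)`.  PROVED below — for PerL's use the citation is provenance only, not an input. -/
def RealApproximation_UH : Prop :=
  ∀ (L : CMField) (m : Type) [Fintype m] [DecidableEq m] (Hm : Matrix m m L),
    (Hm.map (conjRingHomK L))ᵀ = Hm → IsUnit Hm.det →
      ∀ u : InfinitePlace L → Matrix m m ℂ, (∀ w, (u w)ᴴ * Hm.map w.embedding * u w = Hm.map w.embedding) →
        u ∈ closure {x : InfinitePlace L → Matrix m m ℂ |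
          ∃ g : GL m L, g ∈ unitaryGroup (conjRingHomK L) Hm ∧ (fun w => (g : Matrix m m L).map w.embedding) = x}

/-- (Ported verbatim from the HodgeCMPerL package; no docstring in the source.) -/
theorem RealApproximation_UH_holds : RealApproximation_UH := by
  intro L m _ _ Hm hH hdet u hu
  exact RealApproximation.unitaryPi_mem_closure L Hm hH hdet u hu

end HodgeCM.Literature

end
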